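import Summits.Parity.BatemanHorn.Theorems.SoloInformedIntraModulusCeiling

/-!
# The Fejér pair identity for an arbitrary finite family of moduli, and its classes

Informed soloist `solo-Parity-informed` (session 145), conjunct `BatemanHorn`, the `d ≥ 3` rung BELOW the parity
wall (`ErdosDivisorSumAsymptotic g`, `g` an irreducible cubic ⟸ the `ℓ¹` profile `HooleyMeanProfile g θ η`,
`θ > 2/3`, `η > 1/3`, of the sums `T(h) = ∑_{E<e≤E'} S_g(h;e)`).  `SoloInformedRootPairCorrelation` proved the Fejér
pair identity for the family of ALL moduli of a range `(E, E']` and `SoloInformedIntraModulusCeiling` drew from it the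
ceiling of bounds with the absolute values inside the sum over the moduli.  This file redoes the identity and the
sandwich for an ARBITRARY finite family `S` of moduli (`U_S(h) = ∑_{e∈S} S_g(h;e)`, `N = ∑_{e∈S} ρ_g(e)` root points
`x_p = ν/e`, `p = ⟨e, ν⟩ ∈ rootPointsOn g S`), as the tool for the class-wise ceilings of the companion file
`SoloInformedInterClassCeiling`:

* `mul_rootPairSumOn_eq`: `H·∑_{p,p'} F_H(x_p − x_{p'}) = H·N² + ∑_{1≤h≤H}(H − h)(‖U_S(h)‖² + ‖U_S(−h)‖²)`;
* `card_mul_sub_card_le_sum_Icc_norm_sq_on`: `N·(H − N) ≤ ∑_{1≤h≤H}(‖U_S(h)‖² + ‖U_S(−h)‖²)` (diagonal `p = p'`);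
* `sub_card_le_sum_Icc_norm_on`: `H − N ≤ ∑_{1≤h≤H}(‖U_S(h)‖ + ‖U_S(−h)‖)` when `N ≥ 1` — the root sums of ANY family
  with a root are small (in `ℓ¹` over the family, with cancellation among its moduli allowed) at no more than `N` of any
  `H` consecutive frequencies;
* classes `S_a = {e ∈ S : c(e) = a}` of a labelling `c`: `∑_a N_a = N` (`sum_card_rootPointsOn_classes`), the triangle
  inequality `‖U_S(h)‖ ≤ ∑_a ‖U_a(h)‖` (`norm_sum_hooleySum_le_sum_classes`) and the Cauchy–Schwarz step of a dispersion
  `‖U_S(h)‖² ≤ #{classes}·∑_a ‖U_a(h)‖²` (`norm_sq_sum_hooleySum_le_card_mul_sum_classes`).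
-/

namespace Summit.Parity.BatemanHorn.Theorems

open Finset Polynomial Literature.NumberTheory.Sieve
open Literature.Barriers.AtomisticToContinuum.HeatConduction (fejer fejer_nonneg fejer_le)

variable {α : Type*} [DecidableEq α]

/-! ### Root points and the Fejér pair sum of an arbitrary finite family of moduli -/

/-- The root points `p = ⟨e, ν⟩`, `e ∈ S`, `0 ≤ ν < e`, `g(ν) ≡ 0 (mod e)`, of a finite family `S` of moduli
(`rootPoints g E E'` is the case `S = (E, E']`). [this work] -/
def rootPointsOn (g : ℤ[X]) (S : Finset ℕ) : Finset (Σ _ : ℕ, ℕ) :=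
  S.sigma fun e => rootResidues g e

/-- `rootPointsOn g (Ioc E E') = rootPoints g E E'`. [this work] -/
theorem rootPointsOn_Ioc (g : ℤ[X]) (E E' : ℕ) : rootPointsOn g (Ioc E E') = rootPoints g E E' := rfl

/-- `N = #rootPointsOn = ∑_{e∈S} ρ_g(e)`. [this work] -/
theorem card_rootPointsOn (g : ℤ[X]) (S : Finset ℕ) :
    #(rootPointsOn g S) = ∑ e ∈ S, polyRootCountMod ![g] e := by
  rw [rootPointsOn, card_sigma]
  exact sum_congr rfl fun e _ => card_rootResidues g e

/-- Monotonicity of the root-point count in the family. [this work] -/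
theorem card_rootPointsOn_mono (g : ℤ[X]) {S S' : Finset ℕ} (h : S ⊆ S') :
    #(rootPointsOn g S) ≤ #(rootPointsOn g S') :=
  card_le_card (sigma_mono h fun _ => le_rfl)

/-- `U_S(h) = ∑_{e∈S} S_g(h;e) = ∑_p e(h·x_p)`. [this work] -/
theorem sum_hooleySum_eq_sum_rootPointsOn (g : ℤ[X]) (S : Finset ℕ) (h : ℤ) :
    ∑ e ∈ S, hooleySum g e h = ∑ p ∈ rootPointsOn g S, eAdd p.1 (h * p.2) := by
  unfold hooleySum rootPointsOn
  rw [sum_sigma]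

/-- `‖U_S(0)‖ = N`. [this work] -/
theorem norm_sum_hooleySum_zero (g : ℤ[X]) (S : Finset ℕ) :
    ‖∑ e ∈ S, hooleySum g e 0‖ = #(rootPointsOn g S) := by
  have : ∑ e ∈ S, hooleySum g e 0 = (#(rootPointsOn g S) : ℂ) := by
    rw [card_rootPointsOn, Nat.cast_sum]
    exact sum_congr rfl fun e _ => hooleySum_zero g e
  rw [this, Complex.norm_natCast]

/-- The trivial bound `‖U_S(h)‖ ≤ N`. [this work] -/
theorem norm_sum_hooleySum_le_card (g : ℤ[X]) (S : Finset ℕ) (h : ℤ) :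
    ‖∑ e ∈ S, hooleySum g e h‖ ≤ #(rootPointsOn g S) := by
  rw [card_rootPointsOn, Nat.cast_sum]
  exact (norm_sum_le _ _).trans (sum_le_sum fun e _ => norm_hooleySum_le g e h)

/-- `‖U_S(h)‖² = ∑_{p,p'} cos(2πh(x_p − x_{p'}))`. [this work] -/
theorem norm_sq_sum_hooleySum (g : ℤ[X]) (S : Finset ℕ) (h : ℤ) :
    ‖∑ e ∈ S, hooleySum g e h‖ ^ 2 =
      ∑ p ∈ rootPointsOn g S, ∑ p' ∈ rootPointsOn g S,
        Real.cos (2 * Real.pi * h * ((p.2 : ℝ) / p.1 - (p'.2 : ℝ) / p'.1)) := by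
  rw [sum_hooleySum_eq_sum_rootPointsOn]
  simp_rw [eAdd_eq_exp_ofReal_mul_I]
  rw [norm_sq_sum_exp_mul_I]
  refine sum_congr rfl fun p _ => sum_congr rfl fun p' _ => ?_
  congr 1
  push_cast
  ring

/-- The Fejér pair sum of the root fractions of the family `S` at scale `1/H`. [this work] -/
noncomputable def rootPairSumOn (g : ℤ[X]) (S : Finset ℕ) (H : ℕ) : ℝ :=
  ∑ p ∈ rootPointsOn g S, ∑ p' ∈ rootPointsOn g S, fejer H ((p.2 : ℝ) / p.1 - (p'.2 : ℝ) / p'.1)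

/-- `rootPairSumOn g (Ioc E E') = rootPairSum g E E'`. [this work] -/
theorem rootPairSumOn_Ioc (g : ℤ[X]) (E E' H : ℕ) : rootPairSumOn g (Ioc E E') H = rootPairSum g E E' H := rfl

/-- **Fejér pair identity for a family**, first form: `H·rootPairSumOn = ∑_{0≤k,k'<H} ‖U_S(k − k')‖²`. [this work] -/
theorem mul_rootPairSumOn_eq_sum_sum (g : ℤ[X]) (S : Finset ℕ) (H : ℕ) :
    (H : ℝ) * rootPairSumOn g S H =
      ∑ k ∈ range H, ∑ k' ∈ range H, ‖∑ e ∈ S, hooleySum g e ((k : ℤ) - k')‖ ^ 2 := by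
  have h1 : ∀ s : ℝ, (H : ℝ) * fejer H s =
      ∑ kk ∈ range H ×ˢ range H, Real.cos (2 * Real.pi * ((kk.1 : ℝ) - kk.2) * s) := fun s => by
    rw [natCast_mul_fejer, sum_product]
  have h2 : ∀ h : ℤ, ‖∑ e ∈ S, hooleySum g e h‖ ^ 2 =
      ∑ pp ∈ rootPointsOn g S ×ˢ rootPointsOn g S,
        Real.cos (2 * Real.pi * h * ((pp.1.2 : ℝ) / pp.1.1 - (pp.2.2 : ℝ) / pp.2.1)) := fun h => by
    rw [norm_sq_sum_hooleySum, sum_product]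
  calc (H : ℝ) * rootPairSumOn g S H
      = ∑ pp ∈ rootPointsOn g S ×ˢ rootPointsOn g S,
          (H : ℝ) * fejer H ((pp.1.2 : ℝ) / pp.1.1 - (pp.2.2 : ℝ) / pp.2.1) := by
        rw [rootPairSumOn, ← sum_product', mul_sum]
    _ = ∑ pp ∈ rootPointsOn g S ×ˢ rootPointsOn g S, ∑ kk ∈ range H ×ˢ range H,
          Real.cos (2 * Real.pi * ((kk.1 : ℝ) - kk.2) * ((pp.1.2 : ℝ) / pp.1.1 - (pp.2.2 : ℝ) / pp.2.1)) :=
        sum_congr rfl fun pp _ => h1 _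
    _ = ∑ kk ∈ range H ×ˢ range H, ∑ pp ∈ rootPointsOn g S ×ˢ rootPointsOn g S,
          Real.cos (2 * Real.pi * ((kk.1 : ℝ) - kk.2) * ((pp.1.2 : ℝ) / pp.1.1 - (pp.2.2 : ℝ) / pp.2.1)) :=
        sum_comm
    _ = ∑ kk ∈ range H ×ˢ range H, ‖∑ e ∈ S, hooleySum g e ((kk.1 : ℤ) - kk.2)‖ ^ 2 :=
        sum_congr rfl fun kk _ => by rw [h2]; push_cast; rfl
    _ = _ := by rw [sum_product]

/-- **Fejér pair identity for a family.**
`H·rootPairSumOn = H·N² + ∑_{0≤d<H} (H − (d+1))·(‖U_S(d+1)‖² + ‖U_S(−(d+1))‖²)`. [this work] -/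
theorem mul_rootPairSumOn_eq (g : ℤ[X]) (S : Finset ℕ) (H : ℕ) :
    (H : ℝ) * rootPairSumOn g S H =
      (H : ℝ) * (#(rootPointsOn g S) : ℝ) ^ 2 +
        ∑ d ∈ range H, ((H : ℝ) - (d + 1)) *
          (‖∑ e ∈ S, hooleySum g e ((d : ℤ) + 1)‖ ^ 2 + ‖∑ e ∈ S, hooleySum g e (-((d : ℤ) + 1))‖ ^ 2) := by
  have key := sum_range_sum_range_sub (fun h => ‖∑ e ∈ S, hooleySum g e h‖ ^ 2) H
  beta_reduce at key
  rw [mul_rootPairSumOn_eq_sum_sum, key, norm_sum_hooleySum_zero]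

/-- The diagonal bound `H·N ≤ rootPairSumOn g S H`. [this work] -/
theorem card_mul_le_rootPairSumOn (g : ℤ[X]) (S : Finset ℕ) (H : ℕ) :
    (H : ℝ) * #(rootPointsOn g S) ≤ rootPairSumOn g S H := by
  unfold rootPairSumOn
  calc (H : ℝ) * #(rootPointsOn g S) = ∑ p ∈ rootPointsOn g S, (H : ℝ) := by
        rw [sum_const, nsmul_eq_mul, mul_comm]
    _ ≤ _ := sum_le_sum fun p hp => by
        have h := single_le_sum (f := fun p' : (Σ _ : ℕ, ℕ) => fejer H ((p.2 : ℝ) / p.1 - (p'.2 : ℝ) / p'.1))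
          (fun p' _ => fejer_nonneg _ _) hp
        simpa only [sub_self, fejer_zero_right] using h

/-- `N·(H − N) ≤ ∑_{1≤h≤H} (‖U_S(h)‖² + ‖U_S(−h)‖²)` for every finite family `S` of moduli. [this work] -/
theorem card_mul_sub_card_le_sum_Icc_norm_sq_on (g : ℤ[X]) (S : Finset ℕ) (H : ℕ) :
    (#(rootPointsOn g S) : ℝ) * ((H : ℝ) - #(rootPointsOn g S)) ≤
      ∑ h ∈ Icc 1 H, (‖∑ e ∈ S, hooleySum g e h‖ ^ 2 + ‖∑ e ∈ S, hooleySum g e (-(h : ℤ))‖ ^ 2) := by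
  set a : ℕ → ℝ := fun d => ‖∑ e ∈ S, hooleySum g e ((d : ℤ) + 1)‖ ^ 2 +
    ‖∑ e ∈ S, hooleySum g e (-((d : ℤ) + 1))‖ ^ 2 with ha
  have ha0 : ∀ d, 0 ≤ a d := fun d => by positivity
  have hIcc : ∑ h ∈ Icc 1 H, (‖∑ e ∈ S, hooleySum g e h‖ ^ 2 + ‖∑ e ∈ S, hooleySum g e (-(h : ℤ))‖ ^ 2) =
      ∑ d ∈ range H, a d := by
    rw [← Finset.Ico_add_one_right_eq_Icc, sum_Ico_eq_sum_range, Nat.add_sub_cancel]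
    exact sum_congr rfl fun d _ => by simp only [ha, Nat.cast_add, Nat.cast_one, add_comm]
  set N : ℝ := (#(rootPointsOn g S) : ℝ) with hN
  have hN0 : 0 ≤ N := Nat.cast_nonneg _
  rcases Nat.eq_zero_or_pos H with rfl | hH
  · rw [hIcc, sum_range_zero, Nat.cast_zero]
    nlinarith
  have hHpos : (0 : ℝ) < H := by exact_mod_cast hH
  have key := mul_rootPairSumOn_eq g S H
  have hdiag := card_mul_le_rootPairSumOn g S H
  have h1 : ∑ d ∈ range H, ((H : ℝ) - (d + 1)) * a d ≤ (H : ℝ) * ∑ d ∈ range H, a d := by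
    rw [mul_sum]
    refine sum_le_sum fun d hd => mul_le_mul_of_nonneg_right ?_ (ha0 d)
    have : (0 : ℝ) ≤ d := Nat.cast_nonneg d
    linarith
  rw [hIcc]
  refine le_of_mul_le_mul_left ?_ hHpos
  have key' : (H : ℝ) * rootPairSumOn g S H = (H : ℝ) * N ^ 2 + ∑ d ∈ range H, ((H : ℝ) - (d + 1)) * a d := key
  have hdiag' : (H : ℝ) * N ≤ rootPairSumOn g S H := hdiag
  nlinarith [key', h1, hdiag']

/-- `H − N ≤ ∑_{1≤h≤H} (‖U_S(h)‖ + ‖U_S(−h)‖)` for every finite family `S` of moduli with at least one root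
(`‖U_S(h)‖² ≤ N·‖U_S(h)‖`). [this work] -/
theorem sub_card_le_sum_Icc_norm_on (g : ℤ[X]) {S : Finset ℕ} (hN : 1 ≤ #(rootPointsOn g S)) (H : ℕ) :
    (H : ℝ) - #(rootPointsOn g S) ≤
      ∑ h ∈ Icc 1 H, (‖∑ e ∈ S, hooleySum g e h‖ + ‖∑ e ∈ S, hooleySum g e (-(h : ℤ))‖) := by
  set N : ℝ := (#(rootPointsOn g S) : ℝ) with hNdef
  have hN' : (1 : ℝ) ≤ N := by rw [hNdef]; exact_mod_cast hN
  have hsq : ∀ h : ℤ, ‖∑ e ∈ S, hooleySum g e h‖ ^ 2 ≤ N * ‖∑ e ∈ S, hooleySum g e h‖ := fun h => by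
    rw [sq]
    exact mul_le_mul_of_nonneg_right (norm_sum_hooleySum_le_card g S h) (norm_nonneg _)
  have h1 := card_mul_sub_card_le_sum_Icc_norm_sq_on g S H
  have h2 : ∑ h ∈ Icc 1 H, (‖∑ e ∈ S, hooleySum g e h‖ ^ 2 + ‖∑ e ∈ S, hooleySum g e (-(h : ℤ))‖ ^ 2) ≤
      N * ∑ h ∈ Icc 1 H, (‖∑ e ∈ S, hooleySum g e h‖ + ‖∑ e ∈ S, hooleySum g e (-(h : ℤ))‖) := by
    rw [mul_sum]
    refine sum_le_sum fun h _ => ?_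
    rw [mul_add]
    exact add_le_add (hsq h) (hsq (-(h : ℤ)))
  exact le_of_mul_le_mul_left (h1.trans h2) (by linarith)

/-! ### Classes -/

/-- The root points of the classes add up to those of the family: `∑_a N_a = N`. [this work] -/
theorem sum_card_rootPointsOn_classes (g : ℤ[X]) (S : Finset ℕ) (c : ℕ → α) :
    ∑ a ∈ S.image c, #(rootPointsOn g {e ∈ S | c e = a}) = #(rootPointsOn g S) := by
  simp_rw [card_rootPointsOn]
  exact sum_fiberwise_of_maps_to (fun _ he => mem_image_of_mem c he) _

/-- `U_S(h) = ∑_a U_a(h)`. [this work] -/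
theorem sum_hooleySum_eq_sum_classes (g : ℤ[X]) (S : Finset ℕ) (c : ℕ → α) (h : ℤ) :
    ∑ e ∈ S, hooleySum g e h = ∑ a ∈ S.image c, ∑ e ∈ S with c e = a, hooleySum g e h :=
  (sum_fiberwise_of_maps_to (fun _ he => mem_image_of_mem c he) _).symm

/-- The triangle inequality over the classes: `‖U_S(h)‖ ≤ ∑_a ‖U_a(h)‖`. [this work] -/
theorem norm_sum_hooleySum_le_sum_classes (g : ℤ[X]) (S : Finset ℕ) (c : ℕ → α) (h : ℤ) :
    ‖∑ e ∈ S, hooleySum g e h‖ ≤ ∑ a ∈ S.image c, ‖∑ e ∈ S with c e = a, hooleySum g e h‖ := by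
  rw [sum_hooleySum_eq_sum_classes g S c h]
  exact norm_sum_le _ _

/-- The first step of a dispersion argument (Cauchy–Schwarz over the classes):
`‖U_S(h)‖² ≤ #{classes}·∑_a ‖U_a(h)‖²`. [this work] -/
theorem norm_sq_sum_hooleySum_le_card_mul_sum_classes (g : ℤ[X]) (S : Finset ℕ) (c : ℕ → α) (h : ℤ) :
    ‖∑ e ∈ S, hooleySum g e h‖ ^ 2 ≤
      #(S.image c) * ∑ a ∈ S.image c, ‖∑ e ∈ S with c e = a, hooleySum g e h‖ ^ 2 :=
  calc ‖∑ e ∈ S, hooleySum g e h‖ ^ 2 ≤ (∑ a ∈ S.image c, ‖∑ e ∈ S with c e = a, hooleySum g e h‖) ^ 2 :=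
        pow_le_pow_left₀ (norm_nonneg _) (norm_sum_hooleySum_le_sum_classes g S c h) 2
    _ ≤ _ := sq_sum_le_card_mul_sum_sq

end Summit.Parity.BatemanHorn.Theorems
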